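import Summits.CriticalPhenomena.CardyFormulaZ2.Theorems.CardyAnchoredRigidityCardyShadowIsolatedDilationDynamicsGlue
import Summits.CriticalPhenomena.CardyFormulaZ2.Theorems.CardySelfRefinementTwoLagsAllLags
import HarnessLib

/-!
# Crux `CardyShadowIsolated` (stmt-CriticalPhenomena-5767) — line `lag-invariance` (strategist s3, ALT line)

The crux (shared verbatim by routes CardyLocalRigidity / CardyAnchoredRigidity): if the Cardy
shadow `g_F` is a product-space cluster point of the bond-`ℤ²` crossing functions
`δ ↦ (R ↦ bondDomainCrossingProb R δ)` as `δ → 0⁺`, then `g_F` is an isolated point of the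
cluster set `Λ' = clusterSet`.

**The cut.**  A competitor `g' ∈ Λ'` near `g_F` is either NOT scale invariant (its dilation
orbit `s ↦ scaleAct s g'` moves) or it IS a fixed point of the dilation flow.  The line splits
the crux along this dichotomy:

* `stub_latticeTwoLags` (S1, the *lattice* statement): halving or thirding the mesh changes no
  crossing probability asymptotically, `P_{δ/2}(R) − P_δ(R) → 0` and `P_{δ/3}(R) − P_δ(R) → 0`
  for every conformal rectangle `R` (Beffara's self-refinement question; the conformal-rectangle
  shadow of `ScaleInvariantLimits`, route CardySelfRefinement, whose Russo engine attacks exactly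
  these two lags).  PROVED HERE: S1 ⇒ every `g' ∈ Λ'` is fixed by `scaleAct (log 2)` and
  `scaleAct (log 3)` (cluster points of a null sequence vanish, exact lattice covariance
  `bondDomainCrossingProb_map_dilation`) ⇒ fixed by EVERY `scaleAct s` (the stabiliser is a
  closed subgroup of `ℝ` — joint continuity of the dilation flow on `Λ'`, landed stub A — and
  `log 2 / log 3 ∉ ℚ`, `AddSubgroup.dense_or_cyclic`).
* `stub_cardyIsolatedAmongFixed` (S2): `g_F` is isolated among the SCALE-INVARIANT cluster
  points — the fixed-point set of the dilation flow on `Λ'` does not accumulate at `g_F`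
  ("the percolation fixed point has no exactly marginal self-dual direction realised by `ℤ²`
  cluster points"; the local, fixed-point form of SymmetryUpgradeR / LinearisedRigidityIsolates).

Composition (sorry-free): S1 ⇒ all of `Λ'` is fixed; S2 then separates `g_F` from every nearby
cluster point, which is the crux text with `U := N`.  No Butler–Waltman, no connectedness.

**Relation to the live line `dilation-dynamics` (stubs C/D/E of the lead, untouched).**  Proved
below: S1 ⇒ D (`stub_cardyUnstableTrivial`) and S1 ⇒ E (`stub_cardyStableTrivial`) outright (a
fixed point converging to `g_F` is `g_F`), and S1 ∧ S2 ⇒ C (`stub_cardyIsolatedInvariant`).  So a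
proof of S1 closes two of the lead's three stubs and reduces the third to S2; conversely the crux
implies S2 trivially (recorded), so S2 is a genuine weakening of the crux and S1 carries the
difference.

References (pages = pages of the materialised arXiv text): V. Beffara, *Is critical 2D
percolation universal?*, Progr. Probab. 60 (2008) 31–58, arXiv:0708.3908 — §4 p.10 (refinement
couplings), §5 pp.15–16 (mixed percolation on the centred square lattice interpolating `ℤ²` and its
refinements; the Russo estimate `Δ(v) = o(δ²)` that would give mesh-refinement invariance; "we were
not able to conclude the proof that way"); O. Schramm, S. Smirnov, *On the scaling limits of planar
percolation*, Ann. Probab. 39 (2011), arXiv:1101.5820, §1 p.3 (RSW gives non-trivial SUBSEQUENTIAL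
limits for bond-`ℤ²`; the limit is identified only on `𝕋`); H. Duminil-Copin, K. K. Kozlowski,
D. Krachun, I. Manolescu, M. Oulamara, *Rotational invariance in critical planar lattice models*,
arXiv:2012.11672, §1.1 p.3 (the RG road "first scaling and rotation invariance, then conformal
invariance"; rotation invariance proved there for FK `q ∈ [1,4]` incl. `q = 1`, the scaling step
not); S. Smirnov, C. R. Acad. Sci. 333 (2001), Thm 1.
-/

noncomputable section

namespace Summit.CriticalPhenomena.CardyFormulaZ2.Cruxes.CardyShadowIsolated.LagInvariance

open Set Filter Topology
open Literature.Probability.RandomPlanarGeometry Literature.Probability.Percolation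
open Summit.CriticalPhenomena.CardyFormulaZ2.Theorems.CardyShadowIsolated.DilationDynamics

/-! ### The two registered stubs -/

/-- **Stub S1 — lattice two-lag invariance** (open; Beffara 2008 §5, arXiv:0708.3908 pp.15–16; DKKMO arXiv:2012.11672 §1.1):
for bond percolation on `ℤ²` at `p = ½` and every conformal rectangle `R`, refining the mesh by a
factor `2` or `3` changes the crossing probability by `o(1)` as `δ → 0⁺`.  Equivalent (proved
below, one direction) to: every cluster point of the crossing functions is fixed by the dilations
`e^{log 2}`, `e^{log 3}`, hence by all dilations.  Implied by `CardyFormulaZ2`; the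
conformal-rectangle shadow of `ScaleInvariantLimits` (stmt-CriticalPhenomena-10265). -/
protected theorem Holds.stub_latticeTwoLags :
    ∀ R : ConformalRectangle,
      Tendsto (fun δ : ℝ => bondDomainCrossingProb R (δ / 2) - bondDomainCrossingProb R δ)
          (nhdsWithin (0 : ℝ) (Set.Ioi 0)) (𝓝 0) ∧
        Tendsto (fun δ : ℝ => bondDomainCrossingProb R (δ / 3) - bondDomainCrossingProb R δ)
          (nhdsWithin (0 : ℝ) (Set.Ioi 0)) (𝓝 0) := by
  sorry

/-- By-name handle of STUB S1. [folklore] -/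
def stub_latticeTwoLags : Prop := type_of% Holds.stub_latticeTwoLags

/-- **Stub S2 — the Cardy shadow is isolated among scale-invariant cluster points** (open; the
fixed-point form of local rigidity): if the Cardy shadow `g` is a cluster point, some
neighbourhood `N` of `g` contains no cluster point `g' ≠ g` that is fixed by every dilation.
Strictly weaker than the crux (`isolatedAmongFixed_of_isolated`); implied by `CardyFormulaZ2`. -/
protected theorem Holds.stub_cardyIsolatedAmongFixed :
    ∀ g : ConformalRectangle → ℝ, IsCardyShadow g → g ∈ clusterSet →
      ∃ N ∈ 𝓝 g, ∀ g' ∈ clusterSet, g' ∈ N → (∀ s : ℝ, scaleAct s g' = g') → g' = g := by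
  sorry

/-- By-name handle of STUB S2. [folklore] -/
def stub_cardyIsolatedAmongFixed : Prop := type_of% Holds.stub_cardyIsolatedAmongFixed

/-! ### S1 ⇒ every cluster point is scale invariant (proved) -/

/-- A real cluster value of a function tending to `0` is `0`. [folklore] -/
theorem eq_zero_of_mapClusterPt_of_tendsto_zero {α : Type*} {F : Filter α} {u : α → ℝ} {y : ℝ}
    (hy : MapClusterPt y F u) (hu : Tendsto u F (𝓝 0)) : y = 0 :=
  eq_of_nhds_neBot (hy.clusterPt.mono hu).neBot

/-- **One lag at the level of cluster points.**  If `P_{δ/k}(R) − P_δ(R) → 0` for every `R`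
(`k > 0`), then every cluster point is fixed by the dilation `e^{log k}`: the pair evaluation
`f ↦ f(kR) − f(R)` is continuous on the product space, `P_δ(kR) = P_{δ/k}(R)` exactly
(`bondDomainCrossingProb_map_dilation`), and a cluster value of a null function is `0`.
[cite: SchrammSmirnov2011, §1] -/
theorem scaleAct_log_eq_self_of_lag {g : ConformalRectangle → ℝ} (hg : g ∈ clusterSet)
    {k : ℝ} (hk : 0 < k)
    (hlag : ∀ R : ConformalRectangle,
      Tendsto (fun δ : ℝ => bondDomainCrossingProb R (δ / k) - bondDomainCrossingProb R δ)
        (nhdsWithin (0 : ℝ) (Set.Ioi 0)) (𝓝 0)) :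
    scaleAct (Real.log k) g = g := by
  funext R
  have hg' : MapClusterPt g (nhdsWithin (0 : ℝ) (Set.Ioi 0))
      (fun (δ : ℝ) (R : ConformalRectangle) => bondDomainCrossingProb R δ) := hg
  have hev : Continuous fun f : ConformalRectangle → ℝ => f (R.map (dilation (Real.log k))) - f R :=
    (continuous_apply _).sub (continuous_apply _)
  have h1 : MapClusterPt (g (R.map (dilation (Real.log k))) - g R) (nhdsWithin (0 : ℝ) (Set.Ioi 0))
      ((fun f : ConformalRectangle → ℝ => f (R.map (dilation (Real.log k))) - f R) ∘
        fun (δ : ℝ) (R : ConformalRectangle) => bondDomainCrossingProb R δ) :=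
    hg'.continuousAt_comp hev.continuousAt
  have h2 : ((fun f : ConformalRectangle → ℝ => f (R.map (dilation (Real.log k))) - f R) ∘
        fun (δ : ℝ) (R : ConformalRectangle) => bondDomainCrossingProb R δ) =
      fun δ : ℝ => bondDomainCrossingProb R (δ / k) - bondDomainCrossingProb R δ := by
    funext δ
    simp only [Function.comp_apply]
    rw [bondDomainCrossingProb_map_dilation, Real.exp_neg, Real.exp_log hk, inv_mul_eq_div]
  rw [h2] at h1
  have h3 : g (R.map (dilation (Real.log k))) - g R = 0 :=
    eq_zero_of_mapClusterPt_of_tendsto_zero h1 (hlag R)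
  show g (R.map (dilation (Real.log k))) = g R
  linarith

/-- The orbit map `s ↦ scaleAct s g` of a cluster point is continuous into the product space
(joint continuity of the dilation flow on `Λ'`, landed stub A `continuous_scaleActOn`).
[cite: SchrammSmirnov2011, §1] -/
theorem continuous_scaleAct_of_mem {g : ConformalRectangle → ℝ} (hg : g ∈ clusterSet) :
    Continuous fun s : ℝ => scaleAct s g := by
  have h1 : Continuous fun s : ℝ => (scaleActOn s ⟨g, hg⟩ : ↥clusterSet) :=
    continuous_scaleActOn.comp (continuous_id.prodMk continuous_const)
  exact continuous_subtype_val.comp h1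

/-- **Two lags give all lags** at the level of one cluster point: the stabiliser
`{s | scaleAct s g = g}` is a closed additive subgroup of `ℝ` containing `log 2` and `log 3`;
`log 2 / log 3 ∉ ℚ` (`int_mul_log_two_eq_int_mul_log_three`, parity of `2ⁿ = 3ᵐ`) makes it
non-cyclic, hence dense (`AddSubgroup.dense_or_cyclic`), hence everything.
[cite: Beffara2008Universal, §5] -/
theorem scaleAct_eq_self_of_two_three {g : ConformalRectangle → ℝ} (hg : g ∈ clusterSet)
    (h2 : scaleAct (Real.log 2) g = g) (h3 : scaleAct (Real.log 3) g = g) (s : ℝ) :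
    scaleAct s g = g := by
  let H : AddSubgroup ℝ :=
    { carrier := {x | scaleAct x g = g}
      add_mem' := by
        intro x y hx hy
        simp only [mem_setOf_eq] at hx hy ⊢
        rw [scaleAct_add, hy, hx]
      zero_mem' := by
        simp only [mem_setOf_eq]
        exact scaleAct_zero g
      neg_mem' := by
        intro x hx
        simp only [mem_setOf_eq] at hx ⊢
        have h : scaleAct (-x) (scaleAct x g) = g := by
          rw [← scaleAct_add, neg_add_cancel, scaleAct_zero]
        rwa [hx] at h }
  have hmem : ∀ {x : ℝ}, x ∈ H ↔ scaleAct x g = g := fun {x} => Iff.rfl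
  have hclosed : IsClosed (H : Set ℝ) :=
    isClosed_eq (continuous_scaleAct_of_mem hg) continuous_const
  have hlog2 : Real.log 2 ∈ H := hmem.2 h2
  have hlog3 : Real.log 3 ∈ H := hmem.2 h3
  have hdense : Dense (H : Set ℝ) := by
    rcases AddSubgroup.dense_or_cyclic H with hd | ⟨a, ha⟩
    · exact hd
    · exfalso
      rw [ha, AddSubgroup.mem_closure_singleton] at hlog2 hlog3
      obtain ⟨m, hm⟩ := hlog2
      obtain ⟨n, hn⟩ := hlog3
      have key : (n : ℝ) * Real.log 2 = (m : ℝ) * Real.log 3 := by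
        rw [← hm, ← hn, zsmul_eq_mul, zsmul_eq_mul]; ring
      have hn0 : n = 0 :=
        Summit.CriticalPhenomena.CardyFormulaZ2.Theorems.int_mul_log_two_eq_int_mul_log_three key
      rw [hn0, zero_zsmul] at hn
      exact (Real.log_pos (by norm_num : (1 : ℝ) < 3)).ne' hn.symm
  have hall : (H : Set ℝ) = univ := by
    rw [← hclosed.closure_eq]; exact hdense.closure_eq
  have hs : s ∈ (H : Set ℝ) := by rw [hall]; exact mem_univ _
  exact hs

/-- **S1 ⇒ every cluster point is invariant under every dilation** (the conformal-rectangle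
shadow of `ScaleInvariantLimits`, from the two lattice lags). [cite: Beffara2008Universal, §5] -/
theorem scaleAct_eq_self_of_latticeTwoLags
    (hS1 : ∀ R : ConformalRectangle,
      Tendsto (fun δ : ℝ => bondDomainCrossingProb R (δ / 2) - bondDomainCrossingProb R δ)
          (nhdsWithin (0 : ℝ) (Set.Ioi 0)) (𝓝 0) ∧
        Tendsto (fun δ : ℝ => bondDomainCrossingProb R (δ / 3) - bondDomainCrossingProb R δ)
          (nhdsWithin (0 : ℝ) (Set.Ioi 0)) (𝓝 0)) :
    ∀ g ∈ clusterSet, ∀ s : ℝ, scaleAct s g = g := by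
  intro g hg s
  have h2 : scaleAct (Real.log 2) g = g :=
    scaleAct_log_eq_self_of_lag hg two_pos fun R => (hS1 R).1
  have h3 : scaleAct (Real.log 3) g = g :=
    scaleAct_log_eq_self_of_lag hg three_pos fun R => (hS1 R).2
  exact scaleAct_eq_self_of_two_three hg h2 h3 s

/-! ### The composition: S1 → S2 → crux, by name, for both route decls -/

/-- **Scale invariance of `Λ'` plus isolation among fixed points give the crux text**: the
isolating neighbourhood is the `N` of S2. [folklore] -/
theorem isolated_of_allLags_of_isolatedAmongFixed
    (hInv : ∀ g ∈ clusterSet, ∀ s : ℝ, scaleAct s g = g)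
    (hS2 : ∀ g : ConformalRectangle → ℝ, IsCardyShadow g → g ∈ clusterSet →
      ∃ N ∈ 𝓝 g, ∀ g' ∈ clusterSet, g' ∈ N → (∀ s : ℝ, scaleAct s g' = g') → g' = g) :
    ∀ g : ConformalRectangle → ℝ,
      (∀ (R : ConformalRectangle)
        (φ : ConformalEquiv UpperHalfPlane.upperHalfPlaneSet R.carrier) (x : Fin 4 → ℝ),
        R.IsUniformizing φ x → g R = cardyFunction (crossRatio x)) →
      MapClusterPt g (nhdsWithin (0 : ℝ) (Set.Ioi 0))
        (fun (δ : ℝ) (R : ConformalRectangle) => Literature.Probability.Percolation.bondDomainCrossingProb R δ) →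
      ∃ U ∈ nhds g, ∀ g' ∈ U,
        MapClusterPt g' (nhdsWithin (0 : ℝ) (Set.Ioi 0))
          (fun (δ : ℝ) (R : ConformalRectangle) => Literature.Probability.Percolation.bondDomainCrossingProb R δ) → g' = g := by
  intro g hshadow hg
  obtain ⟨N, hN, hsep⟩ := hS2 g hshadow hg
  exact ⟨N, hN, fun g' hg'N hg' => hsep g' hg' hg'N (hInv g' hg')⟩

/-- **`CardyShadowIsolated_of`**: S1 → S2 → the crux BY NAME (route CardyLocalRigidity, the
primary route of the shared item stmt-CriticalPhenomena-5767). [folklore] -/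
theorem CardyShadowIsolated_of (hS1 : stub_latticeTwoLags) (hS2 : stub_cardyIsolatedAmongFixed) :
    Summit.CriticalPhenomena.CardyFormulaZ2.Theses.CardyLocalRigidity.CardyShadowIsolated :=
  isolated_of_allLags_of_isolatedAmongFixed (scaleAct_eq_self_of_latticeTwoLags fun R => hS1 R)
    fun g hg hgΛ => hS2 g hg hgΛ

/-- The same composition for the sibling route decl (route CardyAnchoredRigidity). [folklore] -/
theorem CardyShadowIsolated_of_anchored (hS1 : stub_latticeTwoLags) (hS2 : stub_cardyIsolatedAmongFixed) :
    Summit.CriticalPhenomena.CardyFormulaZ2.Theses.CardyAnchoredRigidity.CardyShadowIsolated :=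
  isolated_of_allLags_of_isolatedAmongFixed (scaleAct_eq_self_of_latticeTwoLags fun R => hS1 R)
    fun g hg hgΛ => hS2 g hg hgΛ

/-- The crux from the two registered stubs (closed modulo `stub_latticeTwoLags`,
`stub_cardyIsolatedAmongFixed`). [folklore] -/
theorem CardyShadowIsolated_proof :
    Summit.CriticalPhenomena.CardyFormulaZ2.Theses.CardyLocalRigidity.CardyShadowIsolated :=
  CardyShadowIsolated_of Holds.stub_latticeTwoLags Holds.stub_cardyIsolatedAmongFixed

/-! ### Cross-line glue to the lead's registered stubs C / D / E of line `dilation-dynamics` -/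

/-- **S1 ⇒ D** (`stub_cardyUnstableTrivial` of the lead, verbatim as conclusion): a fixed point
whose backward orbit converges to `g` is `g`. [folklore] -/
theorem cardyUnstableTrivial_of_allLags (hInv : ∀ g ∈ clusterSet, ∀ s : ℝ, scaleAct s g = g) :
    ∀ g : ConformalRectangle → ℝ, IsCardyShadow g → ∀ g' ∈ clusterSet,
      Tendsto (fun s : ℝ => scaleAct s g') atBot (𝓝 g) → g' = g := by
  intro g _ g' hg' ht
  have hconst : (fun s : ℝ => scaleAct s g') = fun _ => g' := funext fun s => hInv g' hg' s
  rw [hconst] at ht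
  exact tendsto_nhds_unique tendsto_const_nhds ht

/-- **S1 ⇒ E** (`stub_cardyStableTrivial` of the lead, verbatim as conclusion). [folklore] -/
theorem cardyStableTrivial_of_allLags (hInv : ∀ g ∈ clusterSet, ∀ s : ℝ, scaleAct s g = g) :
    ∀ g : ConformalRectangle → ℝ, IsCardyShadow g → ∀ g' ∈ clusterSet,
      Tendsto (fun s : ℝ => scaleAct s g') atTop (𝓝 g) → g' = g := by
  intro g _ g' hg' ht
  have hconst : (fun s : ℝ => scaleAct s g') = fun _ => g' := funext fun s => hInv g' hg' s
  rw [hconst] at ht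
  exact tendsto_nhds_unique tendsto_const_nhds ht

/-- **S1 ∧ S2 ⇒ C** (`stub_cardyIsolatedInvariant` of the lead, verbatim as conclusion): with
all of `Λ'` fixed, "the whole orbit of `g'` stays in `N`" is just "`g' ∈ N`". [folklore] -/
theorem cardyIsolatedInvariant_of_allLags_of_isolatedAmongFixed
    (hInv : ∀ g ∈ clusterSet, ∀ s : ℝ, scaleAct s g = g)
    (hS2 : ∀ g : ConformalRectangle → ℝ, IsCardyShadow g → g ∈ clusterSet →
      ∃ N ∈ 𝓝 g, ∀ g' ∈ clusterSet, g' ∈ N → (∀ s : ℝ, scaleAct s g' = g') → g' = g) :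
    ∀ g : ConformalRectangle → ℝ, IsCardyShadow g → g ∈ clusterSet →
      ∃ N ∈ 𝓝 g, ∀ g' ∈ clusterSet, (∀ s : ℝ, scaleAct s g' ∈ N) → g' = g := by
  intro g hsh hg
  obtain ⟨N, hN, hsep⟩ := hS2 g hsh hg
  refine ⟨N, hN, fun g' hg' horb => hsep g' hg' ?_ (hInv g' hg')⟩
  have h0 := horb 0
  rwa [scaleAct_zero] at h0

/-- **The crux implies S2** (S2 is a genuine weakening; S1 carries the difference). [folklore] -/
theorem isolatedAmongFixed_of_isolated
    (h : Summit.CriticalPhenomena.CardyFormulaZ2.Theses.CardyLocalRigidity.CardyShadowIsolated) :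
    stub_cardyIsolatedAmongFixed := by
  intro g hsh hg
  obtain ⟨U, hU, hsep⟩ := h g hsh hg
  exact ⟨U, hU, fun g' hg' hg'U _ => hsep g' hg'U hg'⟩

end Summit.CriticalPhenomena.CardyFormulaZ2.Cruxes.CardyShadowIsolated.LagInvariance

end
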